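import Mathlib
import Summits.RiemannHypothesis.RiemannHypothesis.Theorems.WeilFarFloorCoshGapMeanRH
import Summits.RiemannHypothesis.RiemannHypothesis.Theorems.WeilFarFloorCoshGapSlopeRH
import Summits.RiemannHypothesis.RiemannHypothesis.Theorems.WeilFarFloorCoshZeroSum
import HarnessLib

/-!
# The floor gap: `e^a`-weighted Cesàro slope `β₂`, and it OSCILLATES — `≥ (2β₂−ε)a` and `≤ (2β₂+ε)a` infinitely often (under RH)

Helper file (`--supports stmt-RiemannHypothesis-0098`, lead-track anchor: Weil-positivity window ladder, format-C far bound),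
pure proofs.  Seat rh-explicit-weil-1 gen16 (memo `run/shared/lean/pub/rh-explicit/rh-explicit-weil-1/FORMAT-K3.md` §17).

From `WeilFarFloorCoshGapMeanRH` (`(1/A²)∫₁^A (λ_max − R_c)R_c → β₂`, `β₂ = Σ_ρ m(ρ)²/|ρ|²`) and the RH law for the cosh quotient
(`|R_c(a) − (e^a + 2a − 2 − 2γ)| ≤ β + 1` eventually, `WeilFarFloorCoshZeroSum`) together with the pointwise slope bound
`λ_max − R_c ≤ (4β₂+1)·a·e^{−a}` (`WeilFarFloorCoshGapSlopeRH`):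
* §1 ★★ `tendsto_cesaro_exp_mul_gap_of_RH`: **`RH → (1/A²)∫₁^A e^a·(λ_max(a) − R_c(a)) da → β₂`** (the weight `R_c` replaced by `e^a`:
  the difference `(λ_max − R_c)(e^a − R_c)` is `O(a²e^{−a})`, bounded);
* §2 the gap energy OSCILLATES about its mean slope: ★ `frequently_gapEnergy_ge_of_RH` / `frequently_gapEnergy_le_of_RH`:
  **`RH → ∀ ε > 0, ∃ᶠ a, (2β₂ − ε)·a ≤ (λ_max(a) − R_c(a))·R_c(a)`** and **`∃ᶠ a, (λ_max(a) − R_c(a))·R_c(a) ≤ (2β₂ + ε)·a`** — so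
  `limsup (λ_max − R_c)R_c/a ∈ [2β₂, 4β₂]` and `liminf ≤ 2β₂`: the coefficient of the floor gap breathes with the zero phases around the
  secular line `2β₂·a`.
Standard axioms only; RH enters as Mathlib's `RiemannHypothesis`.  Nothing here bears on the truth of RH.
-/

set_option linter.dupNamespace false
set_option autoImplicit false

noncomputable section

open MeasureTheory Set Filter Topology
open scoped Real BigOperators ArithmeticFunction.vonMangoldt Chebyshev

namespace Summit.RiemannHypothesis.RiemannHypothesis.Theorems.WeilFormatC

namespace FloorResidualMean

open Literature.NumberTheory.LFunctions FloorCosh FloorCoshSplit FloorSecondOrder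

/-! ## §1 The `e^a`-weighted Cesàro mean -/

/-- Under RH, eventually `|e^a·(λ_max − R_c) − (λ_max − R_c)·R_c| ≤ K₀` with an absolute `K₀`: the gap is `≤ (4β₂+1)a e^{−a}`
and `|e^a − R_c| ≤ 2a + 5`. -/
theorem eventually_abs_exp_mul_gap_sub_gapEnergy_le_of_RH (hRH : RiemannHypothesis) :
    ∃ K₀ a₀ : ℝ, 0 ≤ K₀ ∧ 1 ≤ a₀ ∧ ∀ a : ℝ, a₀ ≤ a →
      |Real.exp a * (farCoercivityFloor a - primeShiftForm a ((Icc (-a) a).indicator (fun y ↦ Real.cosh (y / 2))) / (a + Real.sinh a))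
        - (farCoercivityFloor a - primeShiftForm a ((Icc (-a) a).indicator (fun y ↦ Real.cosh (y / 2))) / (a + Real.sinh a))
          * (primeShiftForm a ((Icc (-a) a).indicator (fun y ↦ Real.cosh (y / 2))) / (a + Real.sinh a))| ≤ K₀ := by
  set β := ∑' ρ : ZetaZeros.riemannZetaNontrivialZeros,
    (riemannZetaZeroOrder (ρ : ℂ) : ℝ) * ((riemannZetaZeroOrder (ρ : ℂ) : ℝ) / ‖(ρ : ℂ)‖ ^ 2) with hβdef
  have hβ0 : 0 ≤ β := tsum_nonneg fun ρ ↦ by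
    have := riemannZetaZeroOrder_nonneg (ZetaZeros.riemannZetaNontrivialZeros.ne_one ρ.2)
    have hm : (0 : ℝ) ≤ riemannZetaZeroOrder (ρ : ℂ) := by exact_mod_cast this
    positivity
  obtain ⟨a₁, hslope⟩ := farCoercivityFloor_sub_coshQuotient_le_slope_of_RH hRH one_pos
  obtain ⟨a₂, hzs⟩ := eventually_atTop.1 (FloorCoshZeroSum.eventually_abs_coshSum_div_sub_le_of_RH hRH one_pos)
  -- (4β+1)·a·e^{−a}·(2a+5) ≤ (4β+1)·7·(a² e^{−a} + … ) is bounded; use a·(2a+5)·e^{−a} ≤ 7a²e^{−a} ≤ 7·(4e^{−2})… we bound by a crude 7·2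
  have hsmall : Tendsto (fun a : ℝ ↦ a ^ 2 * Real.exp (-a)) atTop (𝓝 0) := Real.tendsto_pow_mul_exp_neg_atTop_nhds_zero 2
  obtain ⟨a₃, h3⟩ := eventually_atTop.1 ((Metric.tendsto_nhds.1 hsmall) 1 one_pos)
  refine ⟨(4 * β + 1) * 7, max (max a₁ a₂) (max a₃ 1), by positivity, le_trans (le_max_right _ _) (le_max_right _ _), fun a ha ↦ ?_⟩
  have ha₁ : a₁ ≤ a := le_trans (le_max_left _ _) (le_trans (le_max_left _ _) ha)
  have ha₂ : a₂ ≤ a := le_trans (le_max_right _ _) (le_trans (le_max_left _ _) ha)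
  have ha₃ : a₃ ≤ a := le_trans (le_max_left _ _) (le_trans (le_max_right _ _) ha)
  have ha1 : 1 ≤ a := le_trans (le_max_right _ _) (le_trans (le_max_right _ _) ha)
  have hs := hslope a ha₁
  have hz := hzs a ha₂
  rw [← primeShiftForm_coshTest a] at hz
  have h3a := h3 a ha₃
  rw [Real.dist_eq, sub_zero, abs_lt] at h3a
  have hRle := coshQuotient_le_farCoercivityFloor (a := a) (by linarith)
  set R := primeShiftForm a ((Icc (-a) a).indicator (fun y ↦ Real.cosh (y / 2))) / (a + Real.sinh a) with hR
  have hgap0 : 0 ≤ farCoercivityFloor a - R := by linarith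
  have hβ' := nicolasBeta_lt'
  have hγ := Real.eulerMascheroniConstant_lt_two_thirds
  have hγ0 := (Real.one_half_lt_eulerMascheroniConstant).le
  have hRe : |Real.exp a - R| ≤ 2 * a + 5 := by
    obtain ⟨h1, h2⟩ := abs_le.1 hz
    rw [abs_le]; constructor <;> nlinarith
  have e : Real.exp a * (farCoercivityFloor a - R) - (farCoercivityFloor a - R) * R
      = (farCoercivityFloor a - R) * (Real.exp a - R) := by ring
  rw [e, abs_mul, abs_of_nonneg hgap0]
  have hprod : (farCoercivityFloor a - R) * |Real.exp a - R| ≤ (4 * β + 1) * a * Real.exp (-a) * (2 * a + 5) :=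
    mul_le_mul hs hRe (abs_nonneg _) (by positivity)
  have hpoly : a * Real.exp (-a) * (2 * a + 5) ≤ 7 := by
    have : a * (2 * a + 5) ≤ 7 * a ^ 2 := by nlinarith
    have h0 : 0 ≤ Real.exp (-a) := (Real.exp_pos _).le
    nlinarith [h3a.2, mul_le_mul_of_nonneg_right this h0]
  calc (farCoercivityFloor a - R) * |Real.exp a - R| ≤ (4 * β + 1) * a * Real.exp (-a) * (2 * a + 5) := hprod
    _ = (4 * β + 1) * (a * Real.exp (-a) * (2 * a + 5)) := by ring
    _ ≤ (4 * β + 1) * 7 := mul_le_mul_of_nonneg_left hpoly (by positivity)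

/-- **THE FLOOR GAP HAS CESÀRO SLOPE `β₂`, `e^a`-weighted form** (under RH):
`(1/A²)∫₁^A e^a·(λ_max(a) − R_c(a)) da → β₂ = Σ_ρ m(ρ)²/|ρ|²`. -/
theorem tendsto_cesaro_exp_mul_gap_of_RH (hRH : RiemannHypothesis) :
    Tendsto (fun A : ℝ ↦ 1 / A ^ 2 * ∫ a in (1 : ℝ)..A, Real.exp a *
        (farCoercivityFloor a - primeShiftForm a ((Icc (-a) a).indicator (fun y ↦ Real.cosh (y / 2))) / (a + Real.sinh a))) atTop
      (𝓝 (∑' ρ : ZetaZeros.riemannZetaNontrivialZeros,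
        (riemannZetaZeroOrder (ρ : ℂ) : ℝ) * ((riemannZetaZeroOrder (ρ : ℂ) : ℝ) / ‖(ρ : ℂ)‖ ^ 2))) := by
  set β := ∑' ρ : ZetaZeros.riemannZetaNontrivialZeros,
    (riemannZetaZeroOrder (ρ : ℂ) : ℝ) * ((riemannZetaZeroOrder (ρ : ℂ) : ℝ) / ‖(ρ : ℂ)‖ ^ 2) with hβdef
  set w : ℝ → ℝ := fun a ↦
    (farCoercivityFloor a - primeShiftForm a ((Icc (-a) a).indicator (fun y ↦ Real.cosh (y / 2))) / (a + Real.sinh a))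
      * (primeShiftForm a ((Icc (-a) a).indicator (fun y ↦ Real.cosh (y / 2))) / (a + Real.sinh a)) with hw
  set v : ℝ → ℝ := fun a ↦ Real.exp a *
    (farCoercivityFloor a - primeShiftForm a ((Icc (-a) a).indicator (fun y ↦ Real.cosh (y / 2))) / (a + Real.sinh a)) with hv
  have hces : Tendsto (fun A : ℝ ↦ 1 / A ^ 2 * ∫ a in (1 : ℝ)..A, w a) atTop (𝓝 β) := tendsto_cesaro_gapEnergy_of_RH hRH
  obtain ⟨K₀, a₀, hK0, ha₀1, hdiff⟩ := eventually_abs_exp_mul_gap_sub_gapEnergy_le_of_RH hRH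
  -- the difference of the two Cesàro means tends to 0
  set h₀ := (∫ a in (1 : ℝ)..a₀, v a) - ∫ a in (1 : ℝ)..a₀, w a with hh₀
  have hbound : ∀ A : ℝ, a₀ ≤ A → |1 / A ^ 2 * (∫ a in (1 : ℝ)..A, v a) - 1 / A ^ 2 * ∫ a in (1 : ℝ)..A, w a|
      ≤ (|h₀| + K₀ * A) * (1 / A ^ 2) := by
    intro A hA
    have hA1 : 1 ≤ A := ha₀1.trans hA
    have hA0 : 0 < A := by linarith
    have hvA := intervalIntegrable_exp_mul_gap A hA1
    have hv₀ := intervalIntegrable_exp_mul_gap a₀ ha₀1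
    have hwA := intervalIntegrable_gapEnergy A hA1
    have hw₀ := intervalIntegrable_gapEnergy a₀ ha₀1
    have hvt : IntervalIntegrable v volume a₀ A := hv₀.symm.trans hvA
    have hwt : IntervalIntegrable w volume a₀ A := hw₀.symm.trans hwA
    have hvs : ∫ a in (1 : ℝ)..A, v a = (∫ a in (1 : ℝ)..a₀, v a) + ∫ a in a₀..A, v a :=
      (intervalIntegral.integral_add_adjacent_intervals hv₀ hvt).symm
    have hws : ∫ a in (1 : ℝ)..A, w a = (∫ a in (1 : ℝ)..a₀, w a) + ∫ a in a₀..A, w a :=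
      (intervalIntegral.integral_add_adjacent_intervals hw₀ hwt).symm
    have htail : |∫ a in a₀..A, (v a - w a)| ≤ K₀ * (A - a₀) := by
      have h1 : |∫ a in a₀..A, (v a - w a)| ≤ ∫ a in a₀..A, |v a - w a| :=
        intervalIntegral.abs_integral_le_integral_abs hA
      have h2 : ∫ a in a₀..A, |v a - w a| ≤ ∫ _ in a₀..A, K₀ :=
        intervalIntegral.integral_mono_on hA (hvt.sub hwt).abs intervalIntegrable_const fun a ha ↦ by
          have := hdiff a ha.1
          simp only [hv, hw]
          exact this
      rw [intervalIntegral.integral_const, smul_eq_mul] at h2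
      linarith
    have hA2 : 0 < A ^ 2 := by positivity
    have e : 1 / A ^ 2 * (∫ a in (1 : ℝ)..A, v a) - 1 / A ^ 2 * ∫ a in (1 : ℝ)..A, w a
        = (h₀ + ∫ a in a₀..A, (v a - w a)) * (1 / A ^ 2) := by
      rw [hvs, hws, intervalIntegral.integral_sub hvt hwt, hh₀]; ring
    rw [e, abs_mul, abs_of_pos (by positivity : (0 : ℝ) < 1 / A ^ 2)]
    refine mul_le_mul_of_nonneg_right ?_ (by positivity)
    calc |h₀ + ∫ a in a₀..A, (v a - w a)| ≤ |h₀| + |∫ a in a₀..A, (v a - w a)| := abs_add_le _ _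
      _ ≤ |h₀| + K₀ * A := by nlinarith [htail, hK0, ha₀1]
  have hzero : Tendsto (fun A : ℝ ↦ (|h₀| + K₀ * A) * (1 / A ^ 2)) atTop (𝓝 0) := by
    have h2 : Tendsto (fun A : ℝ ↦ 1 / A ^ 2) atTop (𝓝 0) := by
      have := (tendsto_inv_atTop_zero (𝕜 := ℝ)).comp (tendsto_pow_atTop (n := 2) two_ne_zero)
      rw [Function.comp_def] at this
      simpa [one_div] using this
    have h3 : Tendsto (fun A : ℝ ↦ K₀ * A⁻¹) atTop (𝓝 (K₀ * 0)) := tendsto_inv_atTop_zero.const_mul K₀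
    rw [mul_zero] at h3
    have h4 := (h2.const_mul |h₀|).add h3
    rw [mul_zero, zero_add] at h4
    refine h4.congr' ?_
    filter_upwards [eventually_gt_atTop (0 : ℝ)] with A hA
    field_simp
  have hdiff0 : Tendsto (fun A : ℝ ↦ 1 / A ^ 2 * (∫ a in (1 : ℝ)..A, v a) - 1 / A ^ 2 * ∫ a in (1 : ℝ)..A, w a) atTop (𝓝 0) := by
    refine squeeze_zero_norm' ?_ hzero
    filter_upwards [eventually_ge_atTop a₀] with A hA
    rw [Real.norm_eq_abs]; exact hbound A hA
  have := hdiff0.add hces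
  rw [zero_add] at this
  exact this.congr fun A ↦ by ring

/-! ## §2 The gap energy oscillates about the secular line `2β₂·a` -/

/-- **Frequently `(λ_max − R_c)R_c ≥ (2β₂ − ε)·a`** (under RH): otherwise the Cesàro mean would stay below `β₂`. -/
theorem frequently_gapEnergy_ge_of_RH (hRH : RiemannHypothesis) {ε : ℝ} (hε : 0 < ε) :
    ∃ᶠ a : ℝ in atTop, (2 * (∑' ρ : ZetaZeros.riemannZetaNontrivialZeros,
        (riemannZetaZeroOrder (ρ : ℂ) : ℝ) * ((riemannZetaZeroOrder (ρ : ℂ) : ℝ) / ‖(ρ : ℂ)‖ ^ 2)) - ε) * a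
      ≤ (farCoercivityFloor a - primeShiftForm a ((Icc (-a) a).indicator (fun y ↦ Real.cosh (y / 2))) / (a + Real.sinh a))
          * (primeShiftForm a ((Icc (-a) a).indicator (fun y ↦ Real.cosh (y / 2))) / (a + Real.sinh a)) := by
  set β := ∑' ρ : ZetaZeros.riemannZetaNontrivialZeros,
    (riemannZetaZeroOrder (ρ : ℂ) : ℝ) * ((riemannZetaZeroOrder (ρ : ℂ) : ℝ) / ‖(ρ : ℂ)‖ ^ 2) with hβdef
  set w : ℝ → ℝ := fun a ↦
    (farCoercivityFloor a - primeShiftForm a ((Icc (-a) a).indicator (fun y ↦ Real.cosh (y / 2))) / (a + Real.sinh a))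
      * (primeShiftForm a ((Icc (-a) a).indicator (fun y ↦ Real.cosh (y / 2))) / (a + Real.sinh a)) with hw
  have hces : Tendsto (fun A : ℝ ↦ 1 / A ^ 2 * ∫ a in (1 : ℝ)..A, w a) atTop (𝓝 β) := tendsto_cesaro_gapEnergy_of_RH hRH
  by_contra hcon
  have hev := Filter.not_frequently.1 hcon
  -- `hev : ∀ᶠ a, ¬ ((2β − ε)a ≤ w a)`, i.e. eventually `w a < (2β − ε)a`
  obtain ⟨a₀, ha₀⟩ := eventually_atTop.1 hev
  set a₁ := max a₀ 1 with ha₁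
  have ha₁1 : 1 ≤ a₁ := le_max_right _ _
  have hlt : ∀ a : ℝ, a₁ ≤ a → w a ≤ (2 * β - ε) * a := fun a ha ↦ by
    have := ha₀ a (le_trans (le_max_left _ _) ha)
    simp only [hw] at this ⊢
    exact (not_le.1 this).le
  -- Ces_w(A) ≤ [h + (2β−ε)(A² − a₁²)/2]/A² → β − ε/2 < β: contradiction with the limit
  set h := ∫ a in (1 : ℝ)..a₁, w a with hh
  have hU : Tendsto (fun A : ℝ ↦ (h - (2 * β - ε) * a₁ ^ 2 / 2) * (1 / A ^ 2) + (β - ε / 2)) atTop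
      (𝓝 ((h - (2 * β - ε) * a₁ ^ 2 / 2) * 0 + (β - ε / 2))) := by
    have h2 : Tendsto (fun A : ℝ ↦ 1 / A ^ 2) atTop (𝓝 0) := by
      have := (tendsto_inv_atTop_zero (𝕜 := ℝ)).comp (tendsto_pow_atTop (n := 2) two_ne_zero)
      rw [Function.comp_def] at this
      simpa [one_div] using this
    exact (h2.const_mul _).add tendsto_const_nhds
  have hlim : (h - (2 * β - ε) * a₁ ^ 2 / 2) * 0 + (β - ε / 2) < β - ε / 4 := by linarith
  have hev1 := hU.eventually_lt_const hlim
  have hev2 := hces.eventually_const_lt (show β - ε / 4 < β by linarith)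
  obtain ⟨A, hA⟩ := (hev1.and (hev2.and (eventually_ge_atTop a₁))).exists
  obtain ⟨hA1, hA2, hAa⟩ := hA
  have hA1' : 1 ≤ A := ha₁1.trans hAa
  have hwA := intervalIntegrable_gapEnergy A hA1'
  have hw₁ := intervalIntegrable_gapEnergy a₁ ha₁1
  have hwt : IntervalIntegrable w volume a₁ A := hw₁.symm.trans hwA
  have hws : ∫ a in (1 : ℝ)..A, w a = h + ∫ a in a₁..A, w a :=
    (intervalIntegral.integral_add_adjacent_intervals hw₁ hwt).symm
  have htail : ∫ a in a₁..A, w a ≤ (2 * β - ε) * ((A ^ 2 - a₁ ^ 2) / 2) := by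
    have h1 : ∫ a in a₁..A, w a ≤ ∫ a in a₁..A, (2 * β - ε) * a :=
      intervalIntegral.integral_mono_on hAa hwt ((by fun_prop : Continuous fun a : ℝ ↦ (2 * β - ε) * a).intervalIntegrable _ _)
        fun a ha ↦ hlt a ha.1
    rw [intervalIntegral.integral_const_mul, integral_id] at h1
    exact h1
  have hA0 : 0 < A := by linarith
  have hces_le : 1 / A ^ 2 * ∫ a in (1 : ℝ)..A, w a ≤ (h - (2 * β - ε) * a₁ ^ 2 / 2) * (1 / A ^ 2) + (β - ε / 2) := by
    rw [hws]
    have e : (h - (2 * β - ε) * a₁ ^ 2 / 2) * (1 / A ^ 2) + (β - ε / 2)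
        = 1 / A ^ 2 * (h + (2 * β - ε) * ((A ^ 2 - a₁ ^ 2) / 2)) := by field_simp; ring
    rw [e]
    exact mul_le_mul_of_nonneg_left (by linarith) (by positivity)
  linarith

/-- **Frequently `(λ_max − R_c)R_c ≤ (2β₂ + ε)·a`** (under RH): otherwise the Cesàro mean would stay above `β₂`. -/
theorem frequently_gapEnergy_le_of_RH (hRH : RiemannHypothesis) {ε : ℝ} (hε : 0 < ε) :
    ∃ᶠ a : ℝ in atTop,
      (farCoercivityFloor a - primeShiftForm a ((Icc (-a) a).indicator (fun y ↦ Real.cosh (y / 2))) / (a + Real.sinh a))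
          * (primeShiftForm a ((Icc (-a) a).indicator (fun y ↦ Real.cosh (y / 2))) / (a + Real.sinh a))
        ≤ (2 * (∑' ρ : ZetaZeros.riemannZetaNontrivialZeros,
          (riemannZetaZeroOrder (ρ : ℂ) : ℝ) * ((riemannZetaZeroOrder (ρ : ℂ) : ℝ) / ‖(ρ : ℂ)‖ ^ 2)) + ε) * a := by
  set β := ∑' ρ : ZetaZeros.riemannZetaNontrivialZeros,
    (riemannZetaZeroOrder (ρ : ℂ) : ℝ) * ((riemannZetaZeroOrder (ρ : ℂ) : ℝ) / ‖(ρ : ℂ)‖ ^ 2) with hβdef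
  set w : ℝ → ℝ := fun a ↦
    (farCoercivityFloor a - primeShiftForm a ((Icc (-a) a).indicator (fun y ↦ Real.cosh (y / 2))) / (a + Real.sinh a))
      * (primeShiftForm a ((Icc (-a) a).indicator (fun y ↦ Real.cosh (y / 2))) / (a + Real.sinh a)) with hw
  have hces : Tendsto (fun A : ℝ ↦ 1 / A ^ 2 * ∫ a in (1 : ℝ)..A, w a) atTop (𝓝 β) := tendsto_cesaro_gapEnergy_of_RH hRH
  by_contra hcon
  have hev := Filter.not_frequently.1 hcon
  obtain ⟨a₀, ha₀⟩ := eventually_atTop.1 hev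
  set a₁ := max a₀ 1 with ha₁
  have ha₁1 : 1 ≤ a₁ := le_max_right _ _
  have hgt : ∀ a : ℝ, a₁ ≤ a → (2 * β + ε) * a ≤ w a := fun a ha ↦ by
    have := ha₀ a (le_trans (le_max_left _ _) ha)
    simp only [hw] at this ⊢
    exact (not_le.1 this).le
  set h := ∫ a in (1 : ℝ)..a₁, w a with hh
  have hL : Tendsto (fun A : ℝ ↦ (h - (2 * β + ε) * a₁ ^ 2 / 2) * (1 / A ^ 2) + (β + ε / 2)) atTop
      (𝓝 ((h - (2 * β + ε) * a₁ ^ 2 / 2) * 0 + (β + ε / 2))) := by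
    have h2 : Tendsto (fun A : ℝ ↦ 1 / A ^ 2) atTop (𝓝 0) := by
      have := (tendsto_inv_atTop_zero (𝕜 := ℝ)).comp (tendsto_pow_atTop (n := 2) two_ne_zero)
      rw [Function.comp_def] at this
      simpa [one_div] using this
    exact (h2.const_mul _).add tendsto_const_nhds
  have hlim : β + ε / 4 < (h - (2 * β + ε) * a₁ ^ 2 / 2) * 0 + (β + ε / 2) := by linarith
  have hev1 := hL.eventually_const_lt hlim
  have hev2 := hces.eventually_lt_const (show β < β + ε / 4 by linarith)
  obtain ⟨A, hA⟩ := (hev1.and (hev2.and (eventually_ge_atTop a₁))).exists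
  obtain ⟨hA1, hA2, hAa⟩ := hA
  have hA1' : 1 ≤ A := ha₁1.trans hAa
  have hwA := intervalIntegrable_gapEnergy A hA1'
  have hw₁ := intervalIntegrable_gapEnergy a₁ ha₁1
  have hwt : IntervalIntegrable w volume a₁ A := hw₁.symm.trans hwA
  have hws : ∫ a in (1 : ℝ)..A, w a = h + ∫ a in a₁..A, w a :=
    (intervalIntegral.integral_add_adjacent_intervals hw₁ hwt).symm
  have htail : (2 * β + ε) * ((A ^ 2 - a₁ ^ 2) / 2) ≤ ∫ a in a₁..A, w a := by
    have h1 : ∫ a in a₁..A, (2 * β + ε) * a ≤ ∫ a in a₁..A, w a :=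
      intervalIntegral.integral_mono_on hAa ((by fun_prop : Continuous fun a : ℝ ↦ (2 * β + ε) * a).intervalIntegrable _ _) hwt
        fun a ha ↦ hgt a ha.1
    rw [intervalIntegral.integral_const_mul, integral_id] at h1
    exact h1
  have hA0 : 0 < A := by linarith
  have hces_ge : (h - (2 * β + ε) * a₁ ^ 2 / 2) * (1 / A ^ 2) + (β + ε / 2) ≤ 1 / A ^ 2 * ∫ a in (1 : ℝ)..A, w a := by
    rw [hws]
    have e : (h - (2 * β + ε) * a₁ ^ 2 / 2) * (1 / A ^ 2) + (β + ε / 2)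
        = 1 / A ^ 2 * (h + (2 * β + ε) * ((A ^ 2 - a₁ ^ 2) / 2)) := by field_simp; ring
    rw [e]
    exact mul_le_mul_of_nonneg_left (by linarith) (by positivity)
  linarith

end FloorResidualMean

end Summit.RiemannHypothesis.RiemannHypothesis.Theorems.WeilFormatC
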